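import Summits.SmoothPoincare4.SmoothPoincare4.Theorems.WeakReductionDescentLowGenusBase
import Summits.SmoothPoincare4.SmoothPoincare4.Statement
import Literature.Topology.FourManifolds.SphereTrisectionsSectors

/-!
# SmoothPoincare4 / WeakReductionDescent — `LowGenusBase`: trisection-genus form, SPC4 shield, non-vacuity (item stmt-SmoothPoincare4-17911)

Part III of the record on the support item `LowGenusBase` (a smooth homotopy 4-sphere with a
Gay–Kirby trisection of genus `≤ 2` is diffeomorphic to `S⁴`; Parts I–II:
`WeakReductionDescentLowGenusBase.lean`, leaves: `WeakReductionDescentLowGenusBaseLeaves.lean`).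
Everything here is unconditional and kernel-checked; nothing here proves the item, which is the
tree's undischarged named fact `Literature.Barriers.SmoothPoincare4.mz_genus_le_two_homotopySphere_gk.{0}`
(`LowGenusBase_iff_mz`).  What this file pins down:

* `gkTrisectionGenus_le_coe_iff` — API for the `ℕ∞`-valued trisection genus of `Trisections.lean`:
  `gkTrisectionGenus X ≤ n ↔` some `(g; k)`-trisection of `X` has `g ≤ n` (no attainment of the
  infimum is needed: if every trisection had `g ≥ n + 1` then `n + 1 ≤ gkTrisectionGenus X ≤ n`).
* `LowGenusBase_iff_gkTrisectionGenus` — the item says exactly: **every smooth homotopy 4-sphere of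
  (Gay–Kirby) trisection genus `≤ 2` is diffeomorphic to `S⁴`** (Meier–Zupan 2017, Thm. 1.2 with
  Meier–Schirmer–Zupan 2016, Thm. 1.2 and Gay–Kirby's Remark 2, homotopy-sphere corollary).
* `LowGenusBase_of_nonemptyDiffeomorphSphere` (+ `smoothPoincare4_iff_forall_nonemptyDiffeomorphSphere`),
  `not_LowGenusBase_iff_exoticTrisectedSphereOfGenusLE_two` — the **shield**: the item is a consequence of the summit
  statement `SmoothPoincare4` itself, and its negation is literally the catalogued technique class
  `ExoticTrisectedSphereOfGenusLE 2` (an exotic 4-sphere of trisection genus `≤ 2`); so no refutation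
  of the item exists short of a disproof of SPC4.
* `LowGenusBase.hypotheses_inhabited` — **non-vacuity**: the hypotheses of the item are inhabited by
  the round `S⁴` with Gay–Kirby's genus-`0` trisection (tree theorem
  `sphere_genusZero_gkTrisection_holds`, §2 of Gay–Kirby), so the item is not provable "for free"
  from an unsatisfiable trisection predicate (as every statement over the older `IsTrisection` was).

Together with Parts I–II: `SmoothPoincare4 → LowGenusBase ↔ mz_genus_le_two_homotopySphere_gk.{0}
↔ LowGenusTrisectionBarrier ↔ sliceA ∧ sliceB`, slice (A) containing Cerf's `Γ₄ = 0`
(`cerf_twistedSphere_four`) and slice (B) Property R + Laudenbach–Poénaru; the item closes the day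
`mz_genus_le_two_homotopySphere_gk` (or `msz_homotopySphere_gk`) is discharged, by
`LowGenusBase_of_mz` (resp. `LowGenusBase_of_msz`).

References: [MeierZupan2017] Thm. 1.2 (arXiv Thm. 1.3) · [MeierSchirmerZupan2016] Thm. 1.2,
Remark 3.12 · [GayKirby2016] Def. 1, Remark 2, §2 (genus-0 trisection of S⁴) · [Kirby1997] Problem 4.89.
-/

-- the registered namespace `Summit.SmoothPoincare4.SmoothPoincare4.Theorems` repeats a component
set_option linter.dupNamespace false

noncomputable section

namespace Summit.SmoothPoincare4.SmoothPoincare4.Theorems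

open scoped Manifold ContDiff ContinuousMap
open Summit.SmoothPoincare4.SmoothPoincare4.Theses.WeakReductionDescent

/-- **The trisection genus is `≤ n` iff some trisection has genus `≤ n`** (`gkTrisectionGenus` is
the `ℕ∞`-valued infimum of the genera of all `(g; k₀, k₁, k₂)`-trisections of `X`, Gay–Kirby's
Remark 2 over `IsGKTrisection`).  `←` is `gkTrisectionGenus_le`; `→`: if every trisection had genus
`≥ n + 1` then `n + 1 ≤ gkTrisectionGenus X ≤ n` in `ℕ∞`. [cite: GayKirby2016, Remark 2] -/
theorem gkTrisectionGenus_le_coe_iff {X : Type} [TopologicalSpace X]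
    [ChartedSpace (EuclideanSpace ℝ (Fin 4)) X] {n : ℕ} :
    Literature.Topology.FourManifolds.gkTrisectionGenus X ≤ (n : ℕ∞) ↔
      ∃ (g : ℕ) (k : Fin 3 → ℕ) (S : Fin 3 → Set X),
        Literature.Topology.FourManifolds.IsGKTrisection X g k S ∧ g ≤ n := by
  constructor
  · intro h
    by_contra hne
    push Not at hne
    have hle : ((n + 1 : ℕ) : ℕ∞) ≤ Literature.Topology.FourManifolds.gkTrisectionGenus X :=
      le_iInf fun g => le_iInf fun k => le_iInf fun S => le_iInf fun hT => by
        exact_mod_cast hne g k S hT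
    have h' : ((n + 1 : ℕ) : ℕ∞) ≤ (n : ℕ∞) := hle.trans h
    exact absurd (by exact_mod_cast h') (Nat.not_succ_le_self n)
  · rintro ⟨g, k, S, hT, hg⟩
    exact (Literature.Topology.FourManifolds.gkTrisectionGenus_le hT).trans (by exact_mod_cast hg)

/-- **`LowGenusBase` in words: every smooth homotopy 4-sphere of trisection genus `≤ 2` is
diffeomorphic to `S⁴`.**  The route item (stated with an explicit trisection `T` of genus `g ≤ 2`)
is equivalent to its form over the trisection genus `gkTrisectionGenus M ≤ 2` of `Trisections.lean`
— the homotopy-sphere corollary of Meier–Zupan's "genus-two trisections are standard" together with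
the genus-`≤ 1` classification. [cite: MeierZupan2017, Thm. 1.2 (arXiv Thm. 1.3)]
[cite: MeierSchirmerZupan2016, Thm. 1.2 and Remark 3.12] -/
theorem LowGenusBase_iff_gkTrisectionGenus :
    Summit.SmoothPoincare4.SmoothPoincare4.Theses.WeakReductionDescent.LowGenusBase ↔
      ∀ (M : Type) [TopologicalSpace M] [T2Space M] [SecondCountableTopology M]
        [ChartedSpace (EuclideanSpace ℝ (Fin 4)) M] [IsManifold (𝓡 4) ∞ M],
        (M ≃ₕ Metric.sphere (0 : EuclideanSpace ℝ (Fin 5)) 1) →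
        Literature.Topology.FourManifolds.gkTrisectionGenus M ≤ 2 →
        Nonempty (Diffeomorph (𝓡 4) (𝓡 4) M (Metric.sphere (0 : EuclideanSpace ℝ (Fin 5)) 1) ∞) := by
  unfold LowGenusBase
  constructor
  · intro h M _ _ _ _ _ e hgen
    obtain ⟨g, k, T, hT, hg⟩ := (gkTrisectionGenus_le_coe_iff (n := 2)).mp (by exact_mod_cast hgen)
    exact h M e g k T hT hg
  · intro h M _ _ _ _ _ e g k T hT hg
    exact h M e ((gkTrisectionGenus_le_coe_iff (n := 2)).mpr ⟨g, k, T, hT, hg⟩)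

/-- **The shield, upper side: `SmoothPoincare4 → LowGenusBase`.**  The summit statement — every
smooth homotopy 4-sphere over the bare binders is diffeomorphic to `S⁴`, Kirby's Problem 4.89, here
as the literal body of `SmoothPoincare4 = Literature.SPC4.SmoothPoincareConjectureFour.{0}` in
Mathlib's form `HomotopyEquiv.NonemptyDiffeomorphSphere M 4` — gives the item outright, forgetting
the trisection.  So the item is a CONSEQUENCE of the conjecture the route attacks (hypothesis `hS`;
this theorem proves nothing about the item by itself). [cite: Kirby1997, Problem 4.89] -/
theorem LowGenusBase_of_nonemptyDiffeomorphSphere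
    (hS : ∀ (M : Type) [TopologicalSpace M] [T2Space M] [SecondCountableTopology M],
      ContinuousMap.HomotopyEquiv.NonemptyDiffeomorphSphere M 4) :
    Summit.SmoothPoincare4.SmoothPoincare4.Theses.WeakReductionDescent.LowGenusBase := by
  unfold LowGenusBase
  intro M _ _ _ c i e _ _ _ _ _
  exact hS M c i e

/-- The hypothesis of `LowGenusBase_of_nonemptyDiffeomorphSphere` is literally the summit statement
`SmoothPoincare4` (definitional unfolding, recorded as an `Iff`). [cite: Kirby1997, Problem 4.89] -/
theorem smoothPoincare4_iff_forall_nonemptyDiffeomorphSphere :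
    _root_.SmoothPoincare4 ↔
      ∀ (M : Type) [TopologicalSpace M] [T2Space M] [SecondCountableTopology M],
        ContinuousMap.HomotopyEquiv.NonemptyDiffeomorphSphere M 4 :=
  Iff.rfl

/-- **The shield, lower side: the negation of the item is literally the catalogued technique class
`ExoticTrisectedSphereOfGenusLE 2`** — a closed connected oriented smooth `X ≃ₕ S⁴` with a
Gay–Kirby trisection of genus `≤ 2` and no diffeomorphism to `S⁴` (`LowGenusTrisectionsStandard.lean`).
[cite: MeierZupan2017, Thm. 1.2 (arXiv Thm. 1.3)] -/
theorem not_LowGenusBase_iff_exoticTrisectedSphereOfGenusLE_two :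
    ¬ Summit.SmoothPoincare4.SmoothPoincare4.Theses.WeakReductionDescent.LowGenusBase ↔
      Literature.Barriers.SmoothPoincare4.ExoticTrisectedSphereOfGenusLE 2 := by
  rw [LowGenusBase_iff_mz]
  exact Literature.Barriers.SmoothPoincare4.exoticTrisectedSphereOfGenusLE_two_iff_not_mz.symm

/-- **Non-vacuity of the item's hypotheses**: the round `S⁴` (bare binders of universe `0`, the
identity homotopy equivalence) carries Gay–Kirby's genus-`0` trisection — the tree's PROVED
`sphere_genusZero_gkTrisection_holds` over the corrected predicate `IsGKTrisection` — so there are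
`M`, `e`, `g ≤ 2`, `k`, `T` satisfying every hypothesis of `LowGenusBase`.  Hence the item is not
provable from an unsatisfiable hypothesis (contrast: every statement over the older, refuted
predicate `IsTrisection` holds vacuously). [cite: GayKirby2016, §2 (arXiv p. 5), first example] -/
theorem LowGenusBase.hypotheses_inhabited :
    ∃ (M : Type) (_ : TopologicalSpace M) (_ : T2Space M) (_ : SecondCountableTopology M)
      (_ : ChartedSpace (EuclideanSpace ℝ (Fin 4)) M) (_ : IsManifold (𝓡 4) ∞ M)
      (_ : M ≃ₕ Metric.sphere (0 : EuclideanSpace ℝ (Fin 5)) 1)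
      (g : ℕ) (k : Fin 3 → ℕ) (T : Fin 3 → Set M),
      Literature.Topology.FourManifolds.IsGKTrisection M g k T ∧ g ≤ 2 := by
  obtain ⟨S, hS⟩ := Literature.Topology.FourManifolds.sphere_genusZero_gkTrisection_holds
  exact ⟨Metric.sphere (0 : EuclideanSpace ℝ (Fin 5)) 1, inferInstance, inferInstance, inferInstance,
    inferInstance, inferInstance, ContinuousMap.HomotopyEquiv.refl _, 0, fun _ => 0, S,
    hS.isGKTrisection, Nat.zero_le _⟩

/-- **The instance of the item at the witness is true** (of course: `M = S⁴`), recorded so that the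
non-vacuity witness is visibly not a counterexample. [cite: GayKirby2016, §2 (arXiv p. 5), first example] -/
theorem LowGenusBase.sphere_instance (g : ℕ) (k : Fin 3 → ℕ)
    (T : Fin 3 → Set (Metric.sphere (0 : EuclideanSpace ℝ (Fin 5)) 1))
    (_hT : Literature.Topology.FourManifolds.IsGKTrisection
      (Metric.sphere (0 : EuclideanSpace ℝ (Fin 5)) 1) g k T) (_hg : g ≤ 2) :
    Nonempty (Diffeomorph (𝓡 4) (𝓡 4) (Metric.sphere (0 : EuclideanSpace ℝ (Fin 5)) 1)
      (Metric.sphere (0 : EuclideanSpace ℝ (Fin 5)) 1) ∞) :=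
  ⟨Diffeomorph.refl _ _ _⟩

end Summit.SmoothPoincare4.SmoothPoincare4.Theorems

end
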